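import Literature.AnabelianGeometry.EtaleTheta.DivisorMonoidsOfGaloisCoveringTempered
import Literature.AnabelianGeometry.EtaleTheta.Discharge.Sec3Prop34iConnectedOfGaloisCovering
import Literature.AnabelianGeometry.EtaleTheta.LogDivisorModelTateTower
import Literature.AnabelianGeometry.EtaleTheta.LogDivisorModelTateTowerArithmetic
import Literature.AnabelianGeometry.EtaleTheta.TemperedFrobenioidOfGaloisCoveringOneComponent
import Literature.AlgebraicGeometry.Frobenioids.QuasiTemperoidConnectedPart
import Literature.AnabelianGeometry.SemiGraphs.CosetCategoriesFSM
import HarnessLib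

/-!
# [EtTh] Prop. 3.4 (i) — NODE CLOSER: the typed structure `DivisorMonoids.Prop34` INHABITED over print's own base
# `D₀ = B^temp(Γ)⁰`, over its small model `CosetCat Γ`, binder-free at the Tate towers of record, and — in the PRINTED
# vocabulary — at the one-component model

S. Mochizuki, *The étale theta function and its Frobenioid-theoretic manifestations*, Publ. RIMS **45** (2009)
[MochizukiEtTh2009], §3, Prop. 3.4 (i), PRIMS PDF p. 74 l. 27–48 (printed p. 300): "(i) `Φ₀(Y^log)`, as well as each of the
monoids `Div⁺(Z_∞^log)^{Gal(Z_∞^log/Y^log)}` appearing in the inductive limit defining `Φ₀(Y^log)`, is perf-factorial [cf.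
[Mzk17], Definition 2.4, (i)].  Moreover, every endomorphism of `Φ₀(Y^log)` or one of the `Div⁺(Z_∞^log)^{Gal(Z_∞^log/Y^log)}`
induced by an endomorphism of `Y^log` over `X^log` is non-dilating [cf. [Mzk17], Definition 1.1, (i)].  In particular, the
functor `Φ₀` defines a divisorial monoid [cf. [Mzk17], Definition 1.1, (i), (ii)] on `D₀` which is, moreover, perf-factorial
and non-dilating."; proof p. 74 l. 70 – p. 75 l. 9; `D₀ := B^temp(X^log)⁰` p. 72 [cite: MochizukiEtTh2009, Prop 3.4 p.74].

PROOF-ONLY companion (abc-iut cell, layer L2, cone node **`EtTh:Prop3.4(i)`**; seat abc-iut-w6-d058 gen 6; abc-iut-L2-lead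
R989; theorems only — no `def`, no `Prop` fact, no instance, nothing restated).  The typed node is the (i)-part of
abc-iut-L2-t3's hypothesis structure `DivisorMonoids.Prop34 (V) (V₀)` (`DivisorMonoids.lean`).  The cell's capstone
`DivisorMonoids.prop34_ofGaloisActionConnected` (`Sec3Prop34iConnectedOfGaloisCovering`, p438397) inhabits it — all five
fields, (i)×3 + (ii)×2 — at the constructed Def. 3.3 (iii) data of the CONNECTED `G`-SET coverings dominated by one universal
combinatorial covering `Z`, for every `(Z, G, A, hZ)`, in the vocabularies of record `treeMonoidVocabWeak` / `treeCatVocab`.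
THIS FILE moves that statement to the bases print actually names and to the models of record, BY NAME:

* §1 **over print's `D₀ = B^temp(Γ)⁰` ON THE NOSE** (abc-iut-w6-d048's `DivisorMonoids.ofGaloisActionTempered A hZ`, p449586
  — only countable `Γ`-sets with OPEN stabilisers, i.e. connected tempered coverings): `isMonoidOn_ofGaloisActionTempered`
  ([FrdI] Def. 1.1 (ii): pull-backs characteristically injective, bijective along FSM-morphisms — monomorphisms of
  `B^temp(Γ)⁰` are bijective on points, abc-iut's `QuasiTemperoid.BTempConnected.connectedPart_injective_of_mono`),
  `objectwise_isDivisorial_ofGaloisActionTempered`, and **`prop34_ofGaloisActionTempered`** — the typed `Prop34` over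
  `B^temp(Γ)⁰` for EVERY topological group `Γ` acting on EVERY `Z : LogDivisorModel` (`A : Z.GaloisAction Γ`), binders = the
  tacit cusp laws `hZ : Z.CuspLaws` (interface datum, GAP G-w6d058-1) only;
* §2 **over the SMALL model `CosetCat Γ ≌ B^temp(Γ)⁰`** (`Γ` tempered; `DivisorMonoids.ofGaloisActionCosetCat`, p449586):
  `prop34_ofGaloisActionCosetCat`;
* §3 **binder-free at the models of record**: `LogDivisorModel.TateTower.prop34_node` (Tate tower v1, abc-iut-w6-d048 /
  w6-d058, `TateTower.action`, cusp laws the THEOREM `TateTower.cuspLaws`, p444705) and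
  `LogDivisorModel.TateTowerArith.Datum.prop34_node` (arithmetic tower, `D.action`, `D.cuspLaws`, p450534) — NO hypothesis;
* §4 **the PRINTED vocabulary** (`treeMonoidVocab`: perf-factorial = [FrdI] Def. 2.4 (i) WITH clause (d)): at the
  one-component model (abc-iut-w6-d048's `OneCompFrd.dm`, p444302, finitely many primes) the LITERAL Prop. 3.4 is inhabited —
  `OneCompFrd.prop34_printed` (perf-factoriality as printed = that file's `hpf_oneComp`).  HONEST COMPANION (not restated
  here): at every `LogDivisorModel` with infinitely many special-fibre components the printed clause (i)(a) is REFUTED for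
  `Div⁺(Z_∞^log)` — abc-iut-w6-d057's `LogDivisorModel.prop34_i_Divplus_printed_iff_finite` /
  `not_isPerfFactorial_Divplus_of_infinite` (`Sec3Prop34iDivPlusPrinted`, p435031; root witness p413961; cell erratum-candidate
  E-14 / finding F-L2d2-1) — which is why the cell reads (i)(a) in `treeMonoidVocabWeak` (`IsPerfFactorialCof`) everywhere else.

HONEST FRAMING: class-(b) constructions over the typed interfaces `LogDivisorModel` / `GaloisAction` / `CuspLaws` (ONE term of
Def. 3.3 (iii)'s inductive limit, Rmk. 3.3.1; nothing asserts they arise from an actual curve); the erratum is displayed, not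
adjudicated; nothing here bears on [IUTchIII] Cor. 3.12; no side taken; typed ≠ proved — here proved, exactly as stated.
-/

namespace Literature.AnabelianGeometry.EtaleTheta

open CategoryTheory Opposite Function Literature.AlgebraicGeometry.Frobenioids Literature.AnabelianGeometry.SemiGraphs

universe u

/-! ### §1 Prop. 3.4 over print's `D₀ = B^temp(Γ)⁰` on the nose -/

namespace DivisorMonoids

open LogDivisorModel.GaloisAction

section Tempered

variable {Γ : Type u} [Group Γ] [TopologicalSpace Γ] {Z : LogDivisorModel.{u}} (A : Z.GaloisAction Γ) (hZ : Z.CuspLaws)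

/-- Injective homomorphisms into SHARP monoids are characteristically injective ([FrdI] §0).
[cite: MochizukiFrdI2008, §0 p.11] -/
private theorem isCharInjective_of_injective_of_isSharp {M N : Type u} [CommMonoid M] [CommMonoid N] (φ : M →* N)
    (hφ : Injective φ) (hN : IsSharp N) : IsCharInjective φ := by
  refine ⟨hφ, fun x y hxy => ?_⟩
  obtain ⟨a, rfl⟩ := Associates.mk_surjective x
  obtain ⟨b, rfl⟩ := Associates.mk_surjective y
  rw [associatesMap_mk, associatesMap_mk, Associates.mk_eq_mk_iff_associated] at hxy
  obtain ⟨v, hv⟩ := hxy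
  have hv1 : (v : N) = 1 := hN.1 _ v.isUnit
  rw [hv1, mul_one] at hv
  rw [hφ hv]

/-- Every `Φ₀(Y)`, `Y ∈ B^temp(Γ)⁰`, is a divisorial monoid (from abc-iut-w6-d057's weak perf-factoriality of every
`Φ₀(S) = Hom_Γ(S, Div⁺(Z^log_∞))`). [cite: MochizukiEtTh2009, Prop 3.4 p.74] -/
theorem objectwise_isDivisorial_ofGaloisActionTempered :
    Objectwise (fun M _ => IsDivisorial M) (ofGaloisActionTempered A hZ).Φ₀ :=
  fun Y => (isPerfFactorialCof_phiZero A ((temperedInclusion Γ).obj Y)).1.isDivisorial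

/-- Pull-back of log-divisors along a MONOMORPHISM of `B^temp(Γ)⁰` is bijective: a monomorphism of connected tempered
coverings is injective on points ([FrdII] Ex. 1.3, `connectedPart_injective_of_mono`) and onto.
[cite: MochizukiEtTh2009, Prop 3.4 p.74] -/
theorem ofGaloisActionTempered_Φ₀_map_bijective_of_mono {Y' Y : ConnectedPart (BTemp Γ)} (f : Y' ⟶ Y) [Mono f] :
    Bijective ((ofGaloisActionTempered A hZ).Φ₀.map f.op).hom :=
  A.phiZeroPull_bijective ((temperedInclusion Γ).map f)
    ⟨QuasiTemperoid.BTempConnected.connectedPart_injective_of_mono f, hom_surjective_temperedInclusion f⟩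

/-- **`Φ₀` is a MONOID ON `D₀ = B^temp(Γ)⁰`** ([FrdI] Def. 1.1 (ii)): pull-backs are characteristically injective (covering
maps of connected tempered coverings are onto, `Φ₀(Y)` is sharp) and bijective along FSM-morphisms (monomorphisms of
`B^temp(Γ)⁰` are bijective). [cite: MochizukiEtTh2009, Prop 3.4 p.74] -/
theorem isMonoidOn_ofGaloisActionTempered : IsMonoidOn (ofGaloisActionTempered A hZ).Φ₀ := by
  refine ⟨fun {Y Y'} f => ?_, fun {Y Y'} f hf => ?_⟩
  · exact isCharInjective_of_injective_of_isSharp _ (ofGaloisActionTempered_Φ₀_map_injective A hZ f.op)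
      (objectwise_isDivisorial_ofGaloisActionTempered A hZ Y').isSharp
  · haveI : Mono f := hf.2
    exact ofGaloisActionTempered_Φ₀_map_bijective_of_mono A hZ f

/-- Every endomorphism of a connected tempered covering pulls log-divisors back NON-DILATINGLY ([FrdI] Def. 1.1 (i); print's
"every endomorphism of `Φ₀(Y^log)` … induced by an endomorphism of `Y^log` over `X^log` is non-dilating", via the cell's
`isNonDilating_phiZeroPull` for every `Γ`-set and every endomorphism). [cite: MochizukiEtTh2009, Prop 3.4 p.74] -/
theorem isNonDilating_ofGaloisActionTempered (Y : (ConnectedPart (BTemp Γ))ᵒᵖ) (f : Y ⟶ Y) :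
    IsNonDilating ((ofGaloisActionTempered A hZ).Φ₀.map f).hom :=
  isNonDilating_phiZeroPull A ((temperedInclusion Γ).obj Y.unop) ((temperedInclusion Γ).map f.unop)

/-- **[EtTh] Prop. 3.4 — (i) in the weak reading of record and (ii) — over print's `D₀ = B^temp(Γ)⁰` ON THE NOSE**: the typed
structure `DivisorMonoids.Prop34` inhabited at `ofGaloisActionTempered A hZ` for EVERY topological group `Γ`, EVERY
`Z : LogDivisorModel` and EVERY Galois action `A : Z.GaloisAction Γ`, at `treeMonoidVocabWeak` / `treeCatVocab` (whose [FrdI]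
Def. 4.5 rationality slots `R`, `R'` the structure does not read).  Only binder: the cusp laws `hZ` (interface datum).
[cite: MochizukiEtTh2009, Prop 3.4 p.74] -/
theorem prop34_ofGaloisActionTempered (R R' : ((ConnectedPart (BTemp Γ))ᵒᵖ ⥤ CommMonCat.{u}) → Prop) :
    (ofGaloisActionTempered A hZ).Prop34 treeMonoidVocabWeak.{u} (treeCatVocab _ R R') :=
  ⟨fun Y => prop34_i_phiZero A ((temperedInclusion Γ).obj Y.unop),
    fun Y f => isNonDilating_ofGaloisActionTempered A hZ Y f,
    (treeCatVocab_isDivisorialOn _ R R' _).mpr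
      ⟨isMonoidOn_ofGaloisActionTempered A hZ, objectwise_isDivisorial_ofGaloisActionTempered A hZ⟩,
    fun Y _ h => mem_fZero_of_divZeroHom_eq_one A ((temperedInclusion Γ).obj Y.unop) h,
    fun Y _ x h => mem_fZero_of_divZeroHom_eq_of A ((temperedInclusion Γ).obj Y.unop) (x := x) h⟩

end Tempered

/-! ### §2 Prop. 3.4 over the small model `CosetCat Γ ≌ B^temp(Γ)⁰` -/

section Small

variable {Γ : Type u} [Group Γ] [TopologicalSpace Γ] [IsTopologicalGroup Γ] (hΓ : IsTempered Γ)
  {Z : LogDivisorModel.{u}} (A : Z.GaloisAction Γ) (hZ : Z.CuspLaws)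

/-- Pull-back along a monomorphism of the small model is bijective (a monomorphism `Γ/U → Γ/V` is injective,
abc-iut's `CosetCat.toFun_injective_of_mono`, and onto). [cite: MochizukiEtTh2009, Prop 3.4 p.74] -/
theorem ofGaloisActionCosetCat_Φ₀_map_bijective_of_mono {Y' Y : CosetCat Γ} (f : Y' ⟶ Y) [Mono f] :
    Bijective ((ofGaloisActionCosetCat hΓ A hZ).Φ₀.map f.op).hom :=
  A.phiZeroPull_bijective ((temperedInclusion Γ).map ((CosetCat.toConnected hΓ).map f))
    ⟨CosetCat.toFun_injective_of_mono f, CosetCat.toFun_surjective f⟩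

/-- `Φ₀` is a monoid on the small model ([FrdI] Def. 1.1 (ii)). [cite: MochizukiEtTh2009, Prop 3.4 p.74] -/
theorem isMonoidOn_ofGaloisActionCosetCat : IsMonoidOn (ofGaloisActionCosetCat hΓ A hZ).Φ₀ := by
  refine ⟨fun {Y Y'} f => ?_, fun {Y Y'} f hf => ?_⟩
  · exact isCharInjective_of_injective_of_isSharp _ (ofGaloisActionCosetCat_Φ₀_map_injective hΓ A hZ f.op)
      (isPerfFactorialCof_phiZero A _).1.isDivisorial.isSharp
  · haveI : Mono f := hf.2
    exact ofGaloisActionCosetCat_Φ₀_map_bijective_of_mono hΓ A hZ f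

/-- **[EtTh] Prop. 3.4 ((i) weak reading, (ii)) over the SMALL model of `D₀`** (`Γ` tempered), every `(Z, A)`; only binder the
cusp laws. [cite: MochizukiEtTh2009, Prop 3.4 p.74] -/
theorem prop34_ofGaloisActionCosetCat (R R' : ((CosetCat Γ)ᵒᵖ ⥤ CommMonCat.{u}) → Prop) :
    (ofGaloisActionCosetCat hΓ A hZ).Prop34 treeMonoidVocabWeak.{u} (treeCatVocab _ R R') :=
  ⟨fun _ => prop34_i_phiZero A _,
    fun _ f => isNonDilating_phiZeroPull A _ ((temperedInclusion Γ).map ((CosetCat.toConnected hΓ).map f.unop)),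
    (treeCatVocab_isDivisorialOn _ R R' _).mpr
      ⟨isMonoidOn_ofGaloisActionCosetCat hΓ A hZ, fun _ => (isPerfFactorialCof_phiZero A _).1.isDivisorial⟩,
    fun _ _ h => mem_fZero_of_divZeroHom_eq_one A _ h,
    fun _ _ x h => mem_fZero_of_divZeroHom_eq_of A _ (x := x) h⟩

end Small

end DivisorMonoids

/-! ### §3 The node, binder-free, at the Tate towers of record -/

namespace LogDivisorModel

/-- **EtTh:Prop3.4(i) (+ (ii)) at the Tate tower v1 with NO hypothesis**: the typed `Prop34` at the Def. 3.3 (iii) data of the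
connected coverings of the universal combinatorial covering of the Tate curve (`TateTower.model`, Galois action
`TateTower.action` of `ℤ` by `U ↦ ϖ^{-n} U`; the cusp laws are the theorem `TateTower.cuspLaws`).
[cite: MochizukiEtTh2009, Prop 3.4 p.74] -/
theorem TateTower.prop34_node
    (R R' : (((GaloisAction.isConnectedGSet (G := Multiplicative ℤ)).FullSubcategory)ᵒᵖ ⥤ CommMonCat.{0}) → Prop) :
    (DivisorMonoids.ofGaloisActionConnected TateTower.action TateTower.cuspLaws).Prop34 treeMonoidVocabWeak.{0}
      (treeCatVocab _ R R') :=
  DivisorMonoids.prop34_ofGaloisActionConnected TateTower.action TateTower.cuspLaws R R'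

/-- **EtTh:Prop3.4(i) (+ (ii)) at the ARITHMETIC Tate tower with NO hypothesis** (every `D : TateTowerArith.Datum K L`: Galois
group `ℤ × Aut(L/K)`, cusp laws the theorem `D.cuspLaws`). [cite: MochizukiEtTh2009, Prop 3.4 p.74] -/
theorem TateTowerArith.Datum.prop34_node {K L : Type} [Field K] [Field L] [Algebra K L] (D : TateTowerArith.Datum K L)
    (R R' : (((GaloisAction.isConnectedGSet (G := TateTowerArith.Grp K L)).FullSubcategory)ᵒᵖ ⥤ CommMonCat.{0}) → Prop) :
    (DivisorMonoids.ofGaloisActionConnected D.action D.cuspLaws).Prop34 treeMonoidVocabWeak.{0} (treeCatVocab _ R R') :=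
  DivisorMonoids.prop34_ofGaloisActionConnected D.action D.cuspLaws R R'

end LogDivisorModel

/-! ### §4 The PRINTED vocabulary at the one-component model -/

namespace OneCompFrd

variable (U : Type) [CommGroup U] (hU : ∀ u : U, (∀ N : ℕ+, ∃ g : U, g ^ (N : ℕ) = u) → u = 1)
  (R R' : ((D₀)ᵒᵖ ⥤ CommMonCat.{0}) → Prop)

/-- **[EtTh] Prop. 3.4 AS PRINTED — `V := treeMonoidVocab`, perf-factorial = [FrdI] Def. 2.4 (i) with clause (d) — is INHABITED
at the one-component model** (`Z_∞ = X`, one special-fibre component, no cusps: finitely many primes, where the printed and the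
weak readings coincide): perf-factoriality as printed is abc-iut-w6-d048's `hpf_oneComp`; the other four fields are the cell's
capstone (vocabulary-independent). [cite: MochizukiEtTh2009, Prop 3.4 p.74] -/
theorem prop34_printed : (dm U hU).Prop34 treeMonoidVocab.{0} (treeCatVocab _ R R') :=
  have h := DivisorMonoids.prop34_ofGaloisActionConnected (act U hU) (LogDivisorModel.cuspLaws_oneComp U hU) R R'
  ⟨fun Y => hpf_oneComp U hU Y, fun Y f => h.isNonDilating Y f, h.isDivisorialOn, h.ker_div₀_le_F₀, h.mem_F₀_of_div₀_mem⟩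

/-- … and, a fortiori, in the weak reading of record. [cite: MochizukiEtTh2009, Prop 3.4 p.74] -/
theorem prop34_node : (dm U hU).Prop34 treeMonoidVocabWeak.{0} (treeCatVocab _ R R') :=
  DivisorMonoids.prop34_ofGaloisActionConnected (act U hU) (LogDivisorModel.cuspLaws_oneComp U hU) R R'

end OneCompFrd

end Literature.AnabelianGeometry.EtaleTheta
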